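import Summits.Ventures.PercRepro.Night2StarIdentity

/-!
# PercRepro — night-2: the local charging claim `(★)` at corank `2`, and its «three long circuits» case
(blind cell pub-perc-repro, night-2 gen 1, on p3's `Night2StarIdentity`)

Over p3's `rec` / `bIn` / `surplus` / `StarCharge` (ruling (qn)): for a basis `B` of a rank-`q` set `G` of a simple matroid
and a point `x ∈ G ∖ B`, the `(q + 1)`-point spanning set `S = B ∪ {x}` holds at most `q + 1 − m(S)` bases — every basis
inside `S` misses exactly one point of `S`, which is not a coloop (`bIn_add_mTr_le_of_card`).  Two consequences, both new
in the kernel (night-4's `Jq_two_nonneg'` needs `(g − q)(g − q + 3) ≥ 12(q − 1)`):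

* **`starCharge_of_card_eq_add_two`** — CORANK `2`: if `|G| = q + 2` then `StarCharge M G q`, hence
  `Jq_two_nonneg_of_card_eq_add_two : 0 ≤ Jq M G q 2` (mine-4's F7: the two singles are not demanded and each pays
  `q/((1 + m)(q + 1 − m)) ≥ 1/(q + 1)`);
* **`rec_ge_of_three_long`** — THREE LONG CIRCUITS: a basis `B` with three points `x, y, z` of `G ∖ B` whose
  `(q + 1)`-sets have `m ≤ q − 8` coloops (fundamental circuits of `≥ 9` points) receives `rec(B) ≥ 2/(q + 1)`: each such
  single pays `≥ 2/(3(q + 1))` (`surplus_div_bIn_ge_of_long`: `[q/(1 + m) − (q + 2)/(q + 1)]/(q + 1 − m) ≥ 2/(3(q + 1))`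
  for `m + 8 ≤ q`).  Paper: `proofs/NIGHT-2-star.md` (Lemma 1, Theorem 4, Proposition 7).
-/

namespace PercRepro.Star

open Finset ThmH SixFour GenQ

variable {α : Type*} [DecidableEq α] {M : Matroid α} [M.Finite]

/-! ## A `(q + 1)`-point spanning set holds at most `q + 1 − m` bases -/

/-- A basis of `G` inside a `(q + 1)`-point set `S` is `S` minus one point that is NOT a coloop of `M|S`. -/
theorem exists_erase_eq_of_mem_bases {G S B : Finset α} {q : ℕ} (hG : G ⊆ gr M) (hS : S ⊆ G)
    (hr : M.eRk (S : Set α) = (q : ℕ∞)) (hcard : S.card = q + 1) (hB : B ∈ Bq M G q) (hBS : B ⊆ S) :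
    ∃ e ∈ S \ coloopsOf M S, S.erase e = B := by
  obtain ⟨-, hrB, hBq⟩ := mem_Bq.1 hB
  have h1 : (S \ B).card = 1 := by
    rw [Finset.card_sdiff_of_subset hBS, hcard, hBq]
    omega
  obtain ⟨e, he⟩ := Finset.card_eq_one.1 h1
  have heS : e ∈ S := by
    have : e ∈ S \ B := by rw [he]; exact Finset.mem_singleton_self e
    exact (Finset.mem_sdiff.1 this).1
  have hBe : S.erase e = B := by
    rw [Finset.erase_eq, ← he, Finset.sdiff_sdiff_eq_self hBS]
  refine ⟨e, Finset.mem_sdiff.2 ⟨heS, ?_⟩, hBe⟩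
  intro hc
  have hcl := (mem_coloopsOf.1 hc).2
  have hstep := eRk_erase_add_one_of_notMem_closure (hS.trans hG) heS hcl
  rw [hBe, hrB, hr] at hstep
  have : (q : ℕ∞) + 1 = (q : ℕ∞) := hstep
  have h' : q + 1 = q := by exact_mod_cast this
  omega

/-- `b(S) + m(S) ≤ q + 1` for a `(q + 1)`-point spanning subset `S` of `G`. -/
theorem bIn_add_mTr_le_of_card {G S : Finset α} {q : ℕ} (hG : G ⊆ gr M) (hS : S ⊆ G)
    (hr : M.eRk (S : Set α) = (q : ℕ∞)) (hcard : S.card = q + 1) : bIn M G q S + mTr M S ≤ q + 1 := by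
  have hsub : (Bq M G q).filter (fun B : Finset α => B ⊆ S) ⊆ (S \ coloopsOf M S).image (fun e => S.erase e) := by
    intro B hB
    rw [Finset.mem_filter] at hB
    obtain ⟨e, he, hBe⟩ := exists_erase_eq_of_mem_bases hG hS hr hcard hB.1 hB.2
    rw [Finset.mem_image]
    exact ⟨e, he, hBe⟩
  have h1 : bIn M G q S ≤ (S \ coloopsOf M S).card :=
    (Finset.card_le_card hsub).trans Finset.card_image_le
  have h2 : (S \ coloopsOf M S).card = S.card - (coloopsOf M S).card :=
    Finset.card_sdiff_of_subset (coloopsOf_subset S)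
  have h3 : (coloopsOf M S).card ≤ S.card := Finset.card_le_card (coloopsOf_subset S)
  unfold mTr
  omega

/-! ## The single `B ∪ {x}` -/

/-- For a basis `B` of `G` and `x ∈ G ∖ B`, the set `B ∪ {x}` is a spanning non-basis of `G` above `B`. -/
theorem insert_mem_SNq {G B : Finset α} {q : ℕ} (hrG : M.eRk (G : Set α) = (q : ℕ∞)) (hB : B ∈ Bq M G q)
    {x : α} (hx : x ∈ G \ B) : insert x B ∈ SNq M G q ∧ (insert x B).card = q + 1 := by
  obtain ⟨hBG, hrB, hBq⟩ := mem_Bq.1 hB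
  have hxG := (Finset.mem_sdiff.1 hx).1
  have hxB := (Finset.mem_sdiff.1 hx).2
  have hsub : insert x B ⊆ G := Finset.insert_subset hxG hBG
  have hcard : (insert x B).card = q + 1 := by
    rw [Finset.card_insert_of_notMem hxB, hBq]
  have hr : M.eRk ((insert x B : Finset α) : Set α) = (q : ℕ∞) := by
    apply le_antisymm
    · have := M.eRk_mono (Finset.coe_subset.2 hsub)
      rw [hrG] at this
      exact this
    · have := M.eRk_mono (Finset.coe_subset.2 (Finset.subset_insert x B))
      rw [hrB] at this
      exact this
  refine ⟨mem_SNq.2 ⟨hsub, hr, ?_⟩, hcard⟩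
  omega

/-- The surplus of a spanning non-basis is at least its demanded value `q/(1 + m) − (q + 2)/(q + 1)`. -/
theorem surplus_ge_dem {G S : Finset α} (q : ℕ) :
    (q : ℚ) * wInf M S - ((q : ℚ) + 2) / ((q : ℚ) + 1) ≤ surplus M G q S := by
  unfold surplus dem
  split_ifs
  · exact le_refl _
  · have : (0 : ℚ) ≤ ((q : ℚ) + 2) / ((q : ℚ) + 1) := by positivity
    linarith

/-- **A long circuit pays `2/(3(q + 1))`**: for a `(q + 1)`-point spanning subset `S` of `G` with `m(S) + 8 ≤ q`,
`s(S)/b(S) ≥ 2/(3(q + 1))`. -/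
theorem surplus_div_bIn_ge_of_long {G S : Finset α} {q : ℕ} (hG : G ⊆ gr M) (hS : S ⊆ G)
    (hr : M.eRk (S : Set α) = (q : ℕ∞)) (hcard : S.card = q + 1) (hm : mTr M S + 8 ≤ q) :
    2 / (3 * ((q : ℚ) + 1)) ≤ surplus M G q S / (bIn M G q S : ℚ) := by
  have hb := bIn_add_mTr_le_of_card hG hS hr hcard
  have hbpos := bIn_pos hG hS hr
  set m : ℚ := (mTr M S : ℚ) with hm_def
  set b : ℚ := (bIn M G q S : ℚ) with hb_def
  have hm0 : (0 : ℚ) ≤ m := by rw [hm_def]; positivity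
  have hmq : m + 8 ≤ q := by rw [hm_def]; exact_mod_cast hm
  have hbq : b + m ≤ (q : ℚ) + 1 := by rw [hb_def, hm_def]; exact_mod_cast hb
  have hb1 : (1 : ℚ) ≤ b := by rw [hb_def]; exact_mod_cast hbpos
  have hq1 : (0 : ℚ) < (q : ℚ) + 1 := by positivity
  have hsur : (q : ℚ) / (1 + m) - ((q : ℚ) + 2) / ((q : ℚ) + 1) ≤ surplus M G q S := by
    have := surplus_ge_dem (M := M) (G := G) (S := S) q
    unfold wInf at this
    rw [hm_def]
    rw [mul_one_div] at this
    exact this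
  have hsur_pos : 2 / (3 * ((q : ℚ) + 1)) * b ≤ (q : ℚ) / (1 + m) - ((q : ℚ) + 2) / ((q : ℚ) + 1) := by
    have h1m : (0 : ℚ) < 1 + m := by linarith
    rw [div_sub_div _ _ h1m.ne' hq1.ne', div_mul_eq_mul_div, div_le_div_iff₀ (by positivity) (by positivity)]
    nlinarith [mul_nonneg hm0 (sub_nonneg.2 hmq), mul_nonneg hm0 hm0, mul_nonneg (sub_nonneg.2 hmq) (sub_nonneg.2 hmq),
      mul_nonneg hm0 (sub_nonneg.2 hbq), mul_nonneg (sub_nonneg.2 hmq) (sub_nonneg.2 hbq)]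
  rw [le_div_iff₀ (by linarith)]
  linarith

/-- **Three long circuits**: a basis `B` of `G` with three points `x, y, z ∈ G ∖ B` such that the singles `B ∪ {x}`,
`B ∪ {y}`, `B ∪ {z}` have at most `q − 8` coloops receives `rec(B) ≥ 2/(q + 1)` (Proposition 7 of the paper). -/
theorem rec_ge_of_three_long (hs : Simple M) {G B : Finset α} {q : ℕ} (hG : G ⊆ gr M)
    (hrG : M.eRk (G : Set α) = (q : ℕ∞)) (hB : B ∈ Bq M G q) {x y z : α} (hx : x ∈ G \ B) (hy : y ∈ G \ B)
    (hz : z ∈ G \ B) (hxy : x ≠ y) (hxz : x ≠ z) (hyz : y ≠ z) (hmx : mTr M (insert x B) + 8 ≤ q)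
    (hmy : mTr M (insert y B) + 8 ≤ q) (hmz : mTr M (insert z B) + 8 ≤ q) :
    2 / ((q : ℚ) + 1) ≤ rec M G q B := by
  obtain ⟨hSx, hcx⟩ := insert_mem_SNq hrG hB hx
  obtain ⟨hSy, hcy⟩ := insert_mem_SNq hrG hB hy
  obtain ⟨hSz, hcz⟩ := insert_mem_SNq hrG hB hz
  have hxB := (Finset.mem_sdiff.1 hx).2
  have hyB := (Finset.mem_sdiff.1 hy).2
  have hzB := (Finset.mem_sdiff.1 hz).2
  -- the three singles are distinct members of the index set of `rec`
  have hne1 : insert x B ≠ insert y B := by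
    intro h
    have : x ∈ insert y B := by rw [← h]; exact Finset.mem_insert_self x B
    rcases Finset.mem_insert.1 this with h' | h'
    · exact hxy h'
    · exact hxB h'
  have hne2 : insert x B ≠ insert z B := by
    intro h
    have : x ∈ insert z B := by rw [← h]; exact Finset.mem_insert_self x B
    rcases Finset.mem_insert.1 this with h' | h'
    · exact hxz h'
    · exact hxB h'
  have hne3 : insert y B ≠ insert z B := by
    intro h
    have : y ∈ insert z B := by rw [← h]; exact Finset.mem_insert_self y B
    rcases Finset.mem_insert.1 this with h' | h'
    · exact hyz h'
    · exact hyB h'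
  set T : Finset (Finset α) := {insert x B, insert y B, insert z B} with hT
  have hTsub : T ⊆ (SNq M G q).filter (fun S : Finset α => B ⊆ S) := by
    intro S hS
    rw [hT] at hS
    simp only [Finset.mem_insert, Finset.mem_singleton] at hS
    rw [Finset.mem_filter]
    rcases hS with rfl | rfl | rfl
    · exact ⟨hSx, Finset.subset_insert x B⟩
    · exact ⟨hSy, Finset.subset_insert y B⟩
    · exact ⟨hSz, Finset.subset_insert z B⟩
  have hrec : ∑ S ∈ T, surplus M G q S / (bIn M G q S : ℚ) ≤ rec M G q B := by
    unfold rec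
    apply Finset.sum_le_sum_of_subset_of_nonneg hTsub
    intro S hS _
    have hS' := (Finset.mem_filter.1 hS).1
    apply div_nonneg (surplus_nonneg hs hG hrG hS')
    positivity
  have hsum : ∑ S ∈ T, surplus M G q S / (bIn M G q S : ℚ) =
      surplus M G q (insert x B) / (bIn M G q (insert x B) : ℚ) +
      (surplus M G q (insert y B) / (bIn M G q (insert y B) : ℚ) +
        surplus M G q (insert z B) / (bIn M G q (insert z B) : ℚ)) := by
    rw [hT, Finset.sum_insert, Finset.sum_pair hne3]
    simp only [Finset.mem_insert, Finset.mem_singleton, not_or]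
    exact ⟨hne1, hne2⟩
  have h1 := surplus_div_bIn_ge_of_long hG (mem_SNq.1 hSx).1 (mem_SNq.1 hSx).2.1 hcx hmx
  have h2 := surplus_div_bIn_ge_of_long hG (mem_SNq.1 hSy).1 (mem_SNq.1 hSy).2.1 hcy hmy
  have h3 := surplus_div_bIn_ge_of_long hG (mem_SNq.1 hSz).1 (mem_SNq.1 hSz).2.1 hcz hmz
  have hq1 : (0 : ℚ) < (q : ℚ) + 1 := by positivity
  have hkey : 2 / ((q : ℚ) + 1) = 3 * (2 / (3 * ((q : ℚ) + 1))) := by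
    field_simp
  rw [hkey]
  linarith

/-! ## Corank `2`: `|G| = q + 2` -/

/-- A non-demanded single (`G ∖ S` is one point) pays `q/((1 + m)(q + 1 − m)) ≥ 1/(q + 1)`. -/
theorem surplus_div_bIn_ge_of_nondem (hs : Simple M) {G S : Finset α} {q : ℕ} (hG : G ⊆ gr M) (hS : S ⊆ G)
    (hr : M.eRk (S : Set α) = (q : ℕ∞)) (hq : 1 ≤ q) (hcard : S.card = q + 1)
    (hnd : ¬ ((2 : ℕ∞) ≤ M.eRk ((G \ S : Finset α) : Set α))) :
    1 / ((q : ℚ) + 1) ≤ surplus M G q S / (bIn M G q S : ℚ) := by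
  have hb := bIn_add_mTr_le_of_card hG hS hr hcard
  have hbpos := bIn_pos hG hS hr
  have hm := mTr_add_two_le_of_spanning_nonbasis hs (hS.trans hG) hr hq (by omega)
  set m : ℚ := (mTr M S : ℚ) with hm_def
  set b : ℚ := (bIn M G q S : ℚ) with hb_def
  have hm0 : (0 : ℚ) ≤ m := by rw [hm_def]; positivity
  have hmq : m + 2 ≤ q := by rw [hm_def]; exact_mod_cast hm
  have hbq : b + m ≤ (q : ℚ) + 1 := by rw [hb_def, hm_def]; exact_mod_cast hb
  have hb1 : (1 : ℚ) ≤ b := by rw [hb_def]; exact_mod_cast hbpos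
  have hq1 : (0 : ℚ) < (q : ℚ) + 1 := by positivity
  have hsur : surplus M G q S = (q : ℚ) / (1 + m) := by
    unfold surplus dem wInf
    rw [if_neg hnd, hm_def, mul_one_div]
    ring
  rw [hsur, le_div_iff₀ (by linarith)]
  have h1m : (0 : ℚ) < 1 + m := by linarith
  rw [div_mul_eq_mul_div, div_le_div_iff₀ hq1 h1m]
  have hb' : b * (1 + m) ≤ ((q : ℚ) + 1 - m) * (1 + m) :=
    mul_le_mul_of_nonneg_right (by linarith) h1m.le
  nlinarith [mul_nonneg (sub_nonneg.2 hmq) (sub_nonneg.2 hmq), mul_nonneg hm0 (sub_nonneg.2 hmq),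
    mul_nonneg hm0 hm0]

/-- **`(★)` at corank `2`**: if `G` has `q + 2` points, every basis of `G` receives `≥ 2/(q + 1)` (Theorem 4 of the
paper; mine-4's F7). -/
theorem starCharge_of_card_eq_add_two (hs : Simple M) {G : Finset α} {q : ℕ} (hG : G ⊆ gr M)
    (hrG : M.eRk (G : Set α) = (q : ℕ∞)) (hq : 1 ≤ q) (hcard : G.card = q + 2) : StarCharge M G q := by
  intro B hB _
  obtain ⟨hBG, hrB, hBq⟩ := mem_Bq.1 hB
  have h2 : (G \ B).card = 2 := by
    rw [Finset.card_sdiff_of_subset hBG, hcard, hBq]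
    omega
  obtain ⟨x, y, hxy, hGB⟩ := Finset.card_eq_two.1 h2
  have hx : x ∈ G \ B := by rw [hGB]; simp
  have hy : y ∈ G \ B := by rw [hGB]; simp
  obtain ⟨hSx, hcx⟩ := insert_mem_SNq hrG hB hx
  obtain ⟨hSy, hcy⟩ := insert_mem_SNq hrG hB hy
  have hxB := (Finset.mem_sdiff.1 hx).2
  have hne : insert x B ≠ insert y B := by
    intro h
    have : x ∈ insert y B := by rw [← h]; exact Finset.mem_insert_self x B
    rcases Finset.mem_insert.1 this with h' | h'
    · exact hxy h'
    · exact hxB h'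
  -- neither single is demanded: `G ∖ (B ∪ {x}) = {y}` has rank `≤ 1`
  have hnd : ∀ {u v : α}, u ∈ G \ B → v ∈ G \ B → u ≠ v → G \ insert u B ⊆ {v} → 
      ¬ ((2 : ℕ∞) ≤ M.eRk ((G \ insert u B : Finset α) : Set α)) := by
    intro u v _ _ _ hsub h
    have hle : M.eRk ((G \ insert u B : Finset α) : Set α) ≤ M.eRk (({v} : Finset α) : Set α) :=
      M.eRk_mono (Finset.coe_subset.2 hsub)
    rw [Finset.coe_singleton] at hle
    have h1 := M.eRk_singleton_le v
    have : (2 : ℕ∞) ≤ 1 := h.trans (hle.trans h1)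
    norm_num at this
  have hsubx : G \ insert x B ⊆ {y} := by
    intro w hw
    rw [Finset.mem_sdiff, Finset.mem_insert, not_or] at hw
    have : w ∈ G \ B := Finset.mem_sdiff.2 ⟨hw.1, hw.2.2⟩
    rw [hGB] at this
    simp only [Finset.mem_insert, Finset.mem_singleton] at this
    rcases this with h | h
    · exact absurd h hw.2.1
    · rw [h]; exact Finset.mem_singleton_self y
  have hsuby : G \ insert y B ⊆ {x} := by
    intro w hw
    rw [Finset.mem_sdiff, Finset.mem_insert, not_or] at hw
    have : w ∈ G \ B := Finset.mem_sdiff.2 ⟨hw.1, hw.2.2⟩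
    rw [hGB] at this
    simp only [Finset.mem_insert, Finset.mem_singleton] at this
    rcases this with h | h
    · rw [h]; exact Finset.mem_singleton_self x
    · exact absurd h hw.2.1
  have hndx := hnd hx hy hxy hsubx
  have hndy := hnd hy hx (Ne.symm hxy) hsuby
  have h1 := surplus_div_bIn_ge_of_nondem hs hG (mem_SNq.1 hSx).1 (mem_SNq.1 hSx).2.1 hq hcx hndx
  have h2 := surplus_div_bIn_ge_of_nondem hs hG (mem_SNq.1 hSy).1 (mem_SNq.1 hSy).2.1 hq hcy hndy
  set T : Finset (Finset α) := {insert x B, insert y B} with hT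
  have hTsub : T ⊆ (SNq M G q).filter (fun S : Finset α => B ⊆ S) := by
    intro S hS
    rw [hT] at hS
    simp only [Finset.mem_insert, Finset.mem_singleton] at hS
    rw [Finset.mem_filter]
    rcases hS with rfl | rfl
    · exact ⟨hSx, Finset.subset_insert x B⟩
    · exact ⟨hSy, Finset.subset_insert y B⟩
  have hrec : ∑ S ∈ T, surplus M G q S / (bIn M G q S : ℚ) ≤ rec M G q B := by
    unfold rec
    apply Finset.sum_le_sum_of_subset_of_nonneg hTsub
    intro S hS _
    have hS' := (Finset.mem_filter.1 hS).1
    apply div_nonneg (surplus_nonneg hs hG hrG hS')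
    positivity
  rw [hT, Finset.sum_pair hne] at hrec
  have hkey : 2 / ((q : ℚ) + 1) = 1 / ((q : ℚ) + 1) + 1 / ((q : ℚ) + 1) := by ring
  rw [hkey]
  linarith

/-- **The type-`2` balance at corank `2`**: `0 ≤ Jq M G q 2` for every rank-`q` set `G` with `q + 2` points of a
simple matroid, every `q ≥ 1`. -/
theorem Jq_two_nonneg_of_card_eq_add_two (hs : Simple M) {G : Finset α} {q : ℕ} (hG : G ⊆ gr M)
    (hrG : M.eRk (G : Set α) = (q : ℕ∞)) (hq : 1 ≤ q) (hcard : G.card = q + 2) : 0 ≤ Jq M G q 2 :=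
  Jq_two_nonneg_of_star hs hG hrG (starCharge_of_card_eq_add_two hs hG hrG hq hcard)

end PercRepro.Star
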